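import Summits.QuantumFields.YangMills.Theorems.BalabanLadderIRColdPurityGaussLawCheckerboard
import Summits.QuantumFields.YangMills.Theorems.BalabanLadderIRColdPuritySlabDecoupling
import HarnessLib

/-!
# Route `BalabanLadder`, crux `IR` (stmt-QuantumFields-19354): the CUBE LAW — `M₀ ≤ I_β(U,V) ≤ M₀·e^{9n²β²L³}` for even `L`,
# hence `Z_β(L³×t)² ≤ e^{18n²β²L³}·Z_β(L³×2t)` and `coldDefect ρ β L ≤ 18·n²·β²·L³`; THE NUMBER at `L = 8` for `471·N·β ≤ 1`
# (part 4 of the Gauss-law series; parts 1–3 = `…GaussLawConcentration`, `…GaussLawDecoupling`, `…GaussLawCheckerboard`)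

Instrument seat `ym-ir-eng-2` (generation g6, transfer-matrix lane), cell `pub/ym-ir` (`--supports stmt-QuantumFields-19354`,
helper; no registered stub is claimed).

**What is proved (all `theorem`s, hypothesis-free, group-blind).**  `G` compact second countable, `ρ` continuous unitary
of dimension `n`, `β ≥ 0`, `p` a bipartition of the sites (`p(x+eᵢ) ↔ ¬p x`; for `2 ∣ L` the checkerboard parity):
* `integral_even_eq_prod` (PRODUCT FORMULA): given the odd temporal links `o`, the even-link integral of `e^{−βS_tm}` is the
  product over even sites of the one-link integrals of part 3 (`measurePreserving_piEquivPiSubtypeProd` splits the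
  temporal-link Haar product into odd × even; `integral_fintype_prod_eq_prod` on the even factor);
* `gaussLaw_two_sided_of_bipartite`, **`gaussLaw_two_sided_cube`** (`2 ∣ L`): ONE constant `M₀ = Π_y e^{−β f_y s̄₀} > 0` with
  `M₀ ≤ I_β(U,V) ≤ M₀·e^{9n²β²L³}` for ALL slices `U, V` (site sandwiches multiplied, `Σ_y f_y² ≤ 18L³`, odd links
  integrated against a probability measure);
* `cyclicPartition_sq_le_of_gaussLaw_two_sided` (GENERIC in the constant: a uniform two-sided Gauss-law bound with ratio
  `e^{c}` gives `Z(t)² ≤ e^{2c}Z(2t)` through `ym-ir-eng-4`'s cut estimate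
  `ColdPuritySlabDecoupling.sq_integral_cyclicProd_le_exp_mul_integral_cyclicProd`, imported, with
  `a = √(min 1 (M₀e^{c}))·e^{−βS₃/2} ∈ [0,1]`);
* **`wilsonFinTorusPartition_sq_le_exp_cube_mul_two_mul`**: `Z_β(L,L,L,t)² ≤ e^{18n²β²L³}·Z_β(L,L,L,2t)` (`2 ∣ L`, `t ≥ 1`);
* **`coldDefect_le_one_sub_exp_cube`**, `coldDefect_le_cube_mul` (even `L ≥ 4`): `coldDefect ρ β L ≤ 1 − e^{−18n²β²L³} ≤ 18n²β²L³`;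
* `coldDefect_latticeRep_le_cube_mul`, **`coldDefect_eight_le_one_div_24_of_cube`** (`471·N·β ≤ 1 ⇒ δᶜ_β(8) ≤ 1/24`),
  `coldDefect_eight_le_inv_two_pow_six_of_cube` (`768·N·β ≤ 1 ⇒ δᶜ_β(8) ≤ 2⁻⁶`) for `r : LatticeRep G` of dimension `N`.

**Reading.**  `SU(2)`, fundamental (`n = 2`, `β_W = 2β`), the decl's MINIMUM box `L = 8`: THE NUMBER's inequality
`δᶜ_β(8) ≤ 1/24` holds IN THE KERNEL for `0 ≤ β_W ≤ 1/471 ≈ 2.12·10⁻³` — ×16 over the `L⁶` law of part 2 (`1/7525`),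
×313 over the linear slab window of `ColdPuritySlabDecoupling.coldDefect_eight_le_one_div_24` (`1/147456`), and now only
≈ 10–17× below the cell's certified-CONDITIONAL corner (`β_W ≤ 0.022–0.036` at `L = 8`, conditional on KP86 + a paper
lemma; E4-P7 / E2-Q2 — NOT a Lean theorem, unchanged by this file).  General threshold `θ` and even side `L`:
`β ≤ √θ/(3√2·n·L^{3/2})`.  Odd `L` (e.g. the `2S+1` tori of `TransferGap`) are not covered by the checkerboard; part 2's
`L⁶` law applies there.

HONEST FRAMING.  Small-`β` bookkeeping in the kernel, group-blind (it holds verbatim for `U(1)`), width 0 toward `PX` /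
`PXcof` (β → ∞ objects); `BalabanLadder.IR` / `.IRcof` are NOT closed (0/1); the Yang–Mills mass gap (Clay) is NOT proved
by any of this; R4 closes only the conditional finite-𝕋⁴ rung `BalabanLadder.UV`.
-/

noncomputable section

open MeasureTheory Filter Function Finset
open Literature.MathematicalPhysics.QuantumFieldTheory

namespace Summit.QuantumFields.YangMills.Cruxes.IR.ColdPurityGaussLaw

/-! ## §1 Product formula and the two-sided Gauss-law bound with the cube law -/

section Assembly

variable {G : Type} [Group G] [TopologicalSpace G] [IsTopologicalGroup G] [CompactSpace G]
  [MeasurableSpace G] [BorelSpace G] [SecondCountableTopology G] {n : ℕ} (ρ : G →* Matrix (Fin n) (Fin n) ℂ)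
  {L : ℕ} [NeZero L] (U V : GaugeConfig 3 L G) (p : Site 3 L → Prop) [DecidablePred p]

omit [SecondCountableTopology G] in
/-- **PRODUCT FORMULA.**  Conditionally on the odd temporal links `o`, the Boltzmann factor `e^{−βS_tm}` integrates over
the even links to a PRODUCT over even sites of one-link integrals (Fubini on the even product space,
`integral_fintype_prod_eq_prod`), the background being `ḡ_o = e.symm (o, 1)`. [folklore] -/
theorem integral_even_eq_prod (hp : ∀ x i, p (x.shift i) ↔ ¬ p x) (β : ℝ) (o : {z : Site 3 L // p z} → G) :
    ∫ e' : {z : Site 3 L // ¬ p z} → G, Real.exp (-(β * sliceTemporalAction ρ U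
        ((MeasurableEquiv.piEquivPiSubtypeProd (fun _ : Site 3 L => G) p).symm (o, e')) V))
        ∂(Measure.pi fun _ => haarProbability G) =
      ∏ y : {z : Site 3 L // ¬ p z}, ∫ a, Real.exp (-(β *
        ∑ P ∈ univ.filter (fun P : Edge 3 L => (if p P.1 then P.1.shift P.2 else P.1) = y),
          (if p P.1 then ((n : ℝ) - (ρ ((MeasurableEquiv.piEquivPiSubtypeProd (fun _ : Site 3 L => G) p).symm
              (o, fun _ => 1) P.1 * V P * a⁻¹ * (U P)⁻¹)).trace.re)
            else ((n : ℝ) - (ρ (a * V P * ((MeasurableEquiv.piEquivPiSubtypeProd (fun _ : Site 3 L => G) p).symm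
              (o, fun _ => 1) (P.1.shift P.2))⁻¹ * (U P)⁻¹)).trace.re)))) ∂haarProbability G := by
  set e := MeasurableEquiv.piEquivPiSubtypeProd (fun _ : Site 3 L => G) p with he
  have hS : ∀ e' : {z : Site 3 L // ¬ p z} → G, sliceTemporalAction ρ U (e.symm (o, e')) V =
      ∑ y : {z : Site 3 L // ¬ p z}, ∑ P ∈ univ.filter (fun P : Edge 3 L => (if p P.1 then P.1.shift P.2 else P.1) = y),
        (if p P.1 then ((n : ℝ) - (ρ (e.symm (o, fun _ => 1) P.1 * V P * (e' y)⁻¹ * (U P)⁻¹)).trace.re)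
          else ((n : ℝ) - (ρ (e' y * V P * (e.symm (o, fun _ => 1) (P.1.shift P.2))⁻¹ * (U P)⁻¹)).trace.re)) := by
    intro e'
    rw [sliceTemporalAction_eq_sum_even ρ U V p hp (e.symm (o, e'))]
    refine sum_congr rfl fun y _ => sum_congr rfl fun P _ => ?_
    have hy : e.symm (o, e') (y : Site 3 L) = e' y := by
      rw [he, piEquivPiSubtypeProd_symm_apply', dif_neg y.2]
    by_cases h : p P.1
    · have h1 : e.symm (o, e') P.1 = e.symm (o, fun _ => 1) P.1 := by
        rw [he, piEquivPiSubtypeProd_symm_apply', piEquivPiSubtypeProd_symm_apply', dif_pos h, dif_pos h]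
      rw [if_pos h, if_pos h, hy, h1]
    · have h' : p (P.1.shift P.2) := (hp P.1 P.2).2 h
      have h1 : e.symm (o, e') (P.1.shift P.2) = e.symm (o, fun _ => 1) (P.1.shift P.2) := by
        rw [he, piEquivPiSubtypeProd_symm_apply', piEquivPiSubtypeProd_symm_apply', dif_pos h', dif_pos h']
      rw [if_neg h, if_neg h, hy, h1]
  set F : {z : Site 3 L // ¬ p z} → G → ℝ := fun y a => Real.exp (-(β *
    ∑ P ∈ univ.filter (fun P : Edge 3 L => (if p P.1 then P.1.shift P.2 else P.1) = y),
      (if p P.1 then ((n : ℝ) - (ρ (e.symm (o, fun _ => 1) P.1 * V P * a⁻¹ * (U P)⁻¹)).trace.re)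
        else ((n : ℝ) - (ρ (a * V P * (e.symm (o, fun _ => 1) (P.1.shift P.2))⁻¹ * (U P)⁻¹)).trace.re)))) with hF
  have hΦ : ∀ e' : {z : Site 3 L // ¬ p z} → G,
      Real.exp (-(β * sliceTemporalAction ρ U (e.symm (o, e')) V)) = ∏ y, F y (e' y) := by
    intro e'
    rw [hS e', mul_sum, ← sum_neg_distrib, Real.exp_sum]
  simp_rw [hΦ]
  exact integral_fintype_prod_eq_prod (𝕜 := ℝ) F

/-- **THE GAUSS-LAW FACTOR UNDER A BIPARTITION: `M₀ ≤ I_β(U,V) ≤ M₀·e^{9n²β²L³}` with ONE constant `M₀ > 0` for all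
slices.**  `β ≥ 0`, continuous unitary `ρ`, `p` a bipartition of the sites of `(ℤ/L)³` (`p(x+eᵢ) ↔ ¬p x`).  Split the
temporal links into odd and even (`measurePreserving_piEquivPiSubtypeProd` + Fubini); given the odd links the even
integral is a product over the `≤ L³`… even sites of site terms (`integral_even_eq_prod`), each between `e^{−βf_y s̄₀}` and
`e^{−βf_y s̄₀}·e^{n²f_y²β²/2}` (`siteTerm_two_sided`); `Σ_y f_y² ≤ 18L³` (`sum_card_fiber_sq_le`). [folklore] -/
theorem gaussLaw_two_sided_of_bipartite (hρ : Continuous ρ) (hρu : ∀ g, ρ g ∈ Matrix.unitaryGroup (Fin n) ℂ)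
    {β : ℝ} (hβ : 0 ≤ β) (hp : ∀ x i, p (x.shift i) ↔ ¬ p x) :
    ∃ M₀ : ℝ, 0 < M₀ ∧ ∀ U V : GaugeConfig 3 L G,
      M₀ ≤ ∫ g, Real.exp (-(β * sliceTemporalAction ρ U g V)) ∂(Measure.pi fun _ : Site 3 L => haarProbability G) ∧
      ∫ g, Real.exp (-(β * sliceTemporalAction ρ U g V)) ∂(Measure.pi fun _ : Site 3 L => haarProbability G) ≤
        M₀ * Real.exp (9 * (n : ℝ) ^ 2 * β ^ 2 * (L : ℝ) ^ 3) := by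
  classical
  set μ₁ : Measure G := haarProbability G with hμ₁
  set s0 : ℝ := (n : ℝ) - ∫ a, (ρ a).trace.re ∂μ₁ with hs0
  set f : Site 3 L → ℕ := fun y => #{P : Edge 3 L | (if p P.1 then P.1.shift P.2 else P.1) = y} with hf
  set M₀ : ℝ := ∏ y : {z : Site 3 L // ¬ p z}, Real.exp (-(β * (f y * s0))) with hM₀
  refine ⟨M₀, prod_pos fun y _ => Real.exp_pos _, fun U V => ?_⟩
  set e := MeasurableEquiv.piEquivPiSubtypeProd (fun _ : Site 3 L => G) p with he
  set πo : Measure ({z : Site 3 L // p z} → G) := Measure.pi fun _ => μ₁ with hπo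
  set πe : Measure ({z : Site 3 L // ¬ p z} → G) := Measure.pi fun _ => μ₁ with hπe
  have hmp : MeasurePreserving e (Measure.pi fun _ : Site 3 L => μ₁) (πo.prod πe) :=
    measurePreserving_piEquivPiSubtypeProd (fun _ : Site 3 L => μ₁) p
  set Φ : (Site 3 L → G) → ℝ := fun g => Real.exp (-(β * sliceTemporalAction ρ U g V)) with hΦ
  have hΦm : Measurable Φ := ((measurable_sliceTemporalAction ρ hρ U V).const_mul β).neg.exp
  have hΦ01 : ∀ g, 0 ≤ Φ g ∧ Φ g ≤ 1 := fun g =>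
    ⟨(Real.exp_pos _).le, exp_neg_sliceTemporalAction_le_one ρ hρu hβ U g V⟩
  have hint : Integrable (fun q => Φ (e.symm q)) (πo.prod πe) :=
    Integrable.of_bound (hΦm.comp e.symm.measurable).aestronglyMeasurable 1
      (Eventually.of_forall fun q => by
        rw [Real.norm_eq_abs, abs_of_nonneg (hΦ01 _).1]; exact (hΦ01 _).2)
  -- split the temporal links into odd and even ones
  have hsplit : ∫ g, Φ g ∂(Measure.pi fun _ : Site 3 L => μ₁) = ∫ o, ∫ e', Φ (e.symm (o, e')) ∂πe ∂πo := by
    rw [← hmp.symm.integral_comp', integral_prod _ hint]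
  -- per odd configuration: product of site terms, bounded on both sides
  have hinner : ∀ o : {z : Site 3 L // p z} → G,
      M₀ ≤ ∫ e', Φ (e.symm (o, e')) ∂πe ∧
        ∫ e', Φ (e.symm (o, e')) ∂πe ≤ M₀ * Real.exp (9 * (n : ℝ) ^ 2 * β ^ 2 * (L : ℝ) ^ 3) := by
    intro o
    have hprod := integral_even_eq_prod ρ U V p hp β o
    simp only [hΦ]
    rw [hprod]
    have hsite := fun y : {z : Site 3 L // ¬ p z} =>
      siteTerm_two_sided ρ U V p hρ hρu β (e.symm (o, fun _ => 1)) (y : Site 3 L)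
    constructor
    · exact prod_le_prod (fun y _ => (Real.exp_pos _).le) fun y _ => (hsite y).1
    · calc _ ≤ ∏ y : {z : Site 3 L // ¬ p z}, Real.exp (-(β * (f y * s0))) *
            Real.exp (((n : ℝ) * f y) ^ 2 * β ^ 2 / 2) :=
            prod_le_prod (fun y _ => integral_nonneg fun a => (Real.exp_pos _).le) fun y _ => (hsite y).2
        _ = M₀ * Real.exp (∑ y : {z : Site 3 L // ¬ p z}, ((n : ℝ) * f y) ^ 2 * β ^ 2 / 2) := by
            rw [prod_mul_distrib, Real.exp_sum]
        _ ≤ M₀ * Real.exp (9 * (n : ℝ) ^ 2 * β ^ 2 * (L : ℝ) ^ 3) := by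
            refine mul_le_mul_of_nonneg_left (Real.exp_le_exp.2 ?_) (prod_nonneg fun y _ => (Real.exp_pos _).le)
            have hsub : ∑ y : {z : Site 3 L // ¬ p z}, ((f y : ℕ) : ℝ) ^ 2 ≤ ∑ y : Site 3 L, ((f y : ℕ) : ℝ) ^ 2 := by
              rw [← sum_subtype (univ.filter fun z : Site 3 L => ¬ p z) (by simp) (fun y => ((f y : ℕ) : ℝ) ^ 2)]
              exact sum_le_sum_of_subset_of_nonneg (filter_subset _ _) fun y _ _ => sq_nonneg _
            have h18 := sum_card_fiber_sq_le p (L := L)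
            have hsum : ∑ y : {z : Site 3 L // ¬ p z}, ((n : ℝ) * f y) ^ 2 * β ^ 2 / 2 =
                (n : ℝ) ^ 2 * β ^ 2 / 2 * ∑ y : {z : Site 3 L // ¬ p z}, ((f y : ℕ) : ℝ) ^ 2 := by
              rw [mul_sum]; exact sum_congr rfl fun y _ => by ring
            rw [hsum]
            have hn : (0 : ℝ) ≤ (n : ℝ) ^ 2 * β ^ 2 / 2 := by positivity
            nlinarith [hsub, h18, hn]
  -- integrate the odd links against a probability measure
  have hinnerInt : Integrable (fun o => ∫ e', Φ (e.symm (o, e')) ∂πe) πo := hint.integral_prod_left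
  rw [hsplit]
  constructor
  · calc M₀ = ∫ _o, M₀ ∂πo := by rw [integral_const, smul_eq_mul, probReal_univ, one_mul]
      _ ≤ _ := integral_mono (integrable_const _) hinnerInt fun o => (hinner o).1
  · calc _ ≤ ∫ _o, M₀ * Real.exp (9 * (n : ℝ) ^ 2 * β ^ 2 * (L : ℝ) ^ 3) ∂πo :=
          integral_mono hinnerInt (integrable_const _) fun o => (hinner o).2
      _ = _ := by rw [integral_const, smul_eq_mul, probReal_univ, one_mul]

/-- **EVEN SIDE ⇒ `M₀ ≤ I_β(U,V) ≤ M₀·e^{9n²β²L³}`.**  For `2 ∣ L` the checkerboard parity `Σ_j (x_j mod 2)` is a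
bipartition of `(ℤ/L)³` (`parity_shift_iff`), so `gaussLaw_two_sided_of_bipartite` applies: the cube law `9n²β²L³`
replaces the `(9/2)n²β²L⁶` of `gaussLaw_le_exp_neg_mul_integral_mul_exp` (part 1). [folklore] -/
theorem gaussLaw_two_sided_cube (hρ : Continuous ρ) (hρu : ∀ g, ρ g ∈ Matrix.unitaryGroup (Fin n) ℂ)
    {β : ℝ} (hβ : 0 ≤ β) (h2 : 2 ∣ L) :
    ∃ M₀ : ℝ, 0 < M₀ ∧ ∀ U V : GaugeConfig 3 L G,
      M₀ ≤ ∫ g, Real.exp (-(β * sliceTemporalAction ρ U g V)) ∂(Measure.pi fun _ : Site 3 L => haarProbability G) ∧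
      ∫ g, Real.exp (-(β * sliceTemporalAction ρ U g V)) ∂(Measure.pi fun _ : Site 3 L => haarProbability G) ≤
        M₀ * Real.exp (9 * (n : ℝ) ^ 2 * β ^ 2 * (L : ℝ) ^ 3) := by
  classical
  exact gaussLaw_two_sided_of_bipartite ρ (fun x : Site 3 L => (∑ j, ZMod.castHom h2 (ZMod 2) (x j)) = 1)
    hρ hρu hβ (parity_shift_iff h2)

end Assembly

/-! ## §2 Period doubling and the purity bound `coldDefect ≤ 18 n² β² L³` -/

section Purity

open Summit.QuantumFields.YangMills.Cruxes.IR.ColdPurityBridge (coldDefect)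
open Summit.QuantumFields.YangMills.Cruxes.IR.ColdPuritySlabDecoupling
  (sq_integral_cyclicProd_le_exp_mul_integral_cyclicProd)

variable {G : Type} [Group G] [TopologicalSpace G] [IsTopologicalGroup G] [CompactSpace G]
  [MeasurableSpace G] [BorelSpace G] [SecondCountableTopology G] {n : ℕ} (ρ : G →* Matrix (Fin n) (Fin n) ℂ)
  {N : ℕ} [NeZero N]

/-- **FROM A UNIFORM TWO-SIDED GAUSS-LAW BOUND TO PERIOD DOUBLING (generic in the constant).**  If ONE constant `M₀ > 0`
has `M₀ ≤ I_β(U,V) ≤ M₀·e^{c}` for all slices, then `Z_β(N³×t)² ≤ e^{2c}·Z_β(N³×m)`, `m = t + t` (`β ≥ 0`, continuous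
unitary `ρ`): eng-4's cut estimate with `a = √(min 1 (M₀e^c))·e^{−βS₃/2} ∈ [0,1]`. [folklore] -/
theorem cyclicPartition_sq_le_of_gaussLaw_two_sided (hρ : Continuous ρ) (hρu : ∀ g, ρ g ∈ Matrix.unitaryGroup (Fin n) ℂ)
    {β : ℝ} (hβ : 0 ≤ β) {c M₀ : ℝ} (hM₀ : 0 < M₀)
    (hI : ∀ U V : GaugeConfig 3 N G,
      M₀ ≤ ∫ g, Real.exp (-(β * sliceTemporalAction ρ U g V)) ∂(Measure.pi fun _ : Site 3 N => haarProbability G) ∧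
      ∫ g, Real.exp (-(β * sliceTemporalAction ρ U g V)) ∂(Measure.pi fun _ : Site 3 N => haarProbability G) ≤
        M₀ * Real.exp c)
    (t : ℕ) [NeZero t] {m : ℕ} [NeZero m] (hm : m = t + t) :
    cyclicPartition ρ β N t ^ 2 ≤ Real.exp (2 * c) * cyclicPartition ρ β N m := by
  obtain ⟨s, rfl⟩ : ∃ s, t = s + 1 := ⟨t - 1, by have := NeZero.ne t; omega⟩
  obtain ⟨k, rfl⟩ : ∃ k, m = k + 1 := ⟨m - 1, by have := NeZero.ne m; omega⟩
  set M : ℝ := min 1 (M₀ * Real.exp c) with hM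
  have hM0 : 0 ≤ M := le_min zero_le_one (by positivity)
  have hM1 : M ≤ 1 := min_le_left _ _
  set r : ℝ := Real.sqrt M with hr
  have hr0 : 0 ≤ r := Real.sqrt_nonneg _
  have hr1 : r ≤ 1 := Real.sqrt_le_one.mpr hM1 |>.trans_eq' rfl
  have hrr : r * r = M := Real.mul_self_sqrt hM0
  set α : GaugeConfig 3 N G → ℝ := fun U => Real.exp (-(β * wilsonAction ρ U / 2)) with hα
  have hα0 : ∀ U, 0 ≤ α U := fun U => (Real.exp_pos _).le
  have hα1 : ∀ U, α U ≤ 1 := fun U => exp_neg_half_wilsonAction_le_one ρ hρu hβ U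
  have hαm : Measurable α :=
    (((WilsonRP.measurable_wilsonAction (d := 3) (L := N) ρ hρ).const_mul β).div_const 2).neg.exp
  set I : GaugeConfig 3 N G → GaugeConfig 3 N G → ℝ := fun U V =>
    ∫ g, Real.exp (-(β * sliceTemporalAction ρ U g V)) ∂(Measure.pi fun _ : Site 3 N => haarProbability G) with hIdef
  have hI1 : ∀ U V, I U V ≤ 1 := fun U V =>
    (WilsonTransferGapExplicit.exp_neg_le_integral_exp_neg_sliceTemporalAction_le ρ hρ hρu hβ U V).2
  have hIM : ∀ U V, I U V ≤ M := fun U V => le_min (hI1 U V) (hI U V).2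
  have hMI : ∀ U V, Real.exp (-c) * M ≤ I U V := fun U V =>
    calc Real.exp (-c) * M ≤ Real.exp (-c) * (M₀ * Real.exp c) :=
          mul_le_mul_of_nonneg_left (min_le_right _ _) (Real.exp_pos _).le
      _ = M₀ := by rw [mul_comm, mul_assoc, ← Real.exp_add]; simp
      _ ≤ I U V := (hI U V).1
  have hK : ∀ U V, wilsonSliceKernel ρ β U V = α U * I U V * α V := fun U V => rfl
  have hlo : ∀ U V, Real.exp (-c) * (r * α U * (r * α V)) ≤ wilsonSliceKernel ρ β U V := fun U V =>
    calc Real.exp (-c) * (r * α U * (r * α V)) = α U * (Real.exp (-c) * M) * α V := by rw [← hrr]; ring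
      _ ≤ α U * I U V * α V := mul_le_mul_of_nonneg_right (mul_le_mul_of_nonneg_left (hMI U V) (hα0 U)) (hα0 V)
      _ = wilsonSliceKernel ρ β U V := (hK U V).symm
  have hhi : ∀ U V, wilsonSliceKernel ρ β U V ≤ r * α U * (r * α V) := fun U V =>
    calc wilsonSliceKernel ρ β U V = α U * I U V * α V := hK U V
      _ ≤ α U * M * α V := mul_le_mul_of_nonneg_right (mul_le_mul_of_nonneg_left (hIM U V) (hα0 U)) (hα0 V)
      _ = r * α U * (r * α V) := by rw [← hrr]; ring
  have hKm : Measurable (uncurry (wilsonSliceKernel ρ β : GaugeConfig 3 N G → GaugeConfig 3 N G → ℝ)) :=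
    (stronglyMeasurable_uncurry_wilsonSliceKernel ρ hρ β).measurable
  have h := sq_integral_cyclicProd_le_exp_mul_integral_cyclicProd
    (μ := Measure.pi fun _ : Edge 3 N => haarProbability G) (a := fun U => r * α U) (c := c) hKm
    (measurable_const.mul hαm) (fun U => mul_nonneg hr0 (hα0 U)) (fun U => mul_le_one₀ hr1 (hα0 U) (hα1 U))
    hlo hhi (t := s + 1) (m := k + 1) hm
  unfold cyclicPartition
  exact h

/-- **`Z_β(L,L,L,t)² ≤ e^{18n²β²L³}·Z_β(L,L,L,2t)` for EVEN `L ≥ 2`** (`β ≥ 0`, `t ≥ 1`, continuous unitary `ρ`): the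
checkerboard Gauss-law bound `gaussLaw_two_sided_cube` in the generic cut estimate. [folklore] -/
theorem wilsonFinTorusPartition_sq_le_exp_cube_mul_two_mul (hρ : Continuous ρ)
    (hρu : ∀ g, ρ g ∈ Matrix.unitaryGroup (Fin n) ℂ) {β : ℝ} (hβ : 0 ≤ β) {L : ℕ} [NeZero L] (h2 : 2 ∣ L)
    (t : ℕ) [NeZero t] :
    wilsonFinTorusPartition ρ β L L L t ^ 2 ≤
      Real.exp (18 * (n : ℝ) ^ 2 * β ^ 2 * (L : ℝ) ^ 3) * wilsonFinTorusPartition ρ β L L L (2 * t) := by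
  classical
  haveI : NeZero (2 * t) := ⟨by have := NeZero.ne t; omega⟩
  obtain ⟨M₀, hM₀, hI⟩ := gaussLaw_two_sided_cube (L := L) ρ hρ hρu hβ h2
  rw [wilsonFinTorusPartition_eq_cyclicPartition hρ hρu β L t,
    wilsonFinTorusPartition_eq_cyclicPartition hρ hρu β L (2 * t)]
  have h := cyclicPartition_sq_le_of_gaussLaw_two_sided (N := L) ρ hρ hρu hβ hM₀ hI t (m := 2 * t) (two_mul t)
  rwa [show 2 * (9 * (n : ℝ) ^ 2 * β ^ 2 * (L : ℝ) ^ 3) = 18 * (n : ℝ) ^ 2 * β ^ 2 * (L : ℝ) ^ 3 by ring] at h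

/-- **`coldDefect ρ β L ≤ 1 − e^{−18n²β²L³}`** for EVEN `L ≥ 4`, `β ≥ 0`, continuous unitary `ρ` of dimension `n` on a
second-countable compact `G`.  Hypothesis-free, group-blind, expansion-free; quadratic in `β`, CUBIC in `L`. [folklore] -/
theorem coldDefect_le_one_sub_exp_cube {ρ : G →* Matrix (Fin n) (Fin n) ℂ} (hρ : Continuous ρ)
    (hρu : ∀ g, ρ g ∈ Matrix.unitaryGroup (Fin n) ℂ) {β : ℝ} (hβ : 0 ≤ β) {L : ℕ} (hL : 4 ≤ L) (h2 : 2 ∣ L) :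
    coldDefect ρ β L ≤ 1 - Real.exp (-(18 * (n : ℝ) ^ 2 * β ^ 2 * (L : ℝ) ^ 3)) := by
  haveI : NeZero L := ⟨by omega⟩
  haveI : NeZero (L / 4) := ⟨by omega⟩
  have hZ : 0 < wilsonFinTorusPartition ρ β L L L (L / 4) := wilsonFinTorusPartition_pos hρ β L L L (L / 4)
  have h := wilsonFinTorusPartition_sq_le_exp_cube_mul_two_mul ρ hρ hρu hβ h2 (L / 4)
  have hratio : Real.exp (-(18 * (n : ℝ) ^ 2 * β ^ 2 * (L : ℝ) ^ 3)) ≤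
      wilsonFinTorusPartition ρ β L L L (2 * (L / 4)) / wilsonFinTorusPartition ρ β L L L (L / 4) ^ 2 := by
    rw [le_div_iff₀ (pow_pos hZ 2), Real.exp_neg, inv_mul_le_iff₀ (Real.exp_pos _)]
    exact h
  unfold coldDefect
  linarith

/-- **`coldDefect ρ β L ≤ 18·n²·β²·L³`** for EVEN `L ≥ 4`, `β ≥ 0` (from `1 − e^{−x} ≤ x`). [folklore] -/
theorem coldDefect_le_cube_mul {ρ : G →* Matrix (Fin n) (Fin n) ℂ} (hρ : Continuous ρ)
    (hρu : ∀ g, ρ g ∈ Matrix.unitaryGroup (Fin n) ℂ) {β : ℝ} (hβ : 0 ≤ β) {L : ℕ} (hL : 4 ≤ L) (h2 : 2 ∣ L) :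
    coldDefect ρ β L ≤ 18 * (n : ℝ) ^ 2 * β ^ 2 * (L : ℝ) ^ 3 := by
  have h := coldDefect_le_one_sub_exp_cube hρ hρu hβ hL h2
  have he := Real.add_one_le_exp (-(18 * (n : ℝ) ^ 2 * β ^ 2 * (L : ℝ) ^ 3))
  linarith

end Purity

section LatticeRepForms

open Summit.QuantumFields.YangMills.Cruxes.IR.ColdPurityBridge (coldDefect)

variable {G : Type} [Group G] [TopologicalSpace G] [IsTopologicalGroup G] [CompactSpace G]
  [MeasurableSpace G] [BorelSpace G]

/-- **Lattice-representation form, cube law**: for every `r : LatticeRep G`, `β ≥ 0`, even `L ≥ 4`: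
`coldDefect r.ρ β L ≤ 18·r.N²·β²·L³`. [folklore] -/
theorem coldDefect_latticeRep_le_cube_mul (r : LatticeRep G) {β : ℝ} (hβ : 0 ≤ β) {L : ℕ} (hL : 4 ≤ L) (h2 : 2 ∣ L) :
    coldDefect r.ρ β L ≤ 18 * (r.N : ℝ) ^ 2 * β ^ 2 * (L : ℝ) ^ 3 := by
  haveI : SecondCountableTopology G :=
    (r.continuous.isClosedEmbedding r.injective).isEmbedding.secondCountableTopology
  exact coldDefect_le_cube_mul r.continuous r.mem_unitary hβ hL h2

/-- **THE NUMBER at the decl's minimum box, cube law: `471·N·β ≤ 1 ⇒ δᶜ_β(8) ≤ 1/24`** for every `r : LatticeRep G` of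
dimension `N`, `β ≥ 0` (`18·N²·β²·8³ = 9216·N²β² ≤ 1/24` iff `221184·N²β² ≤ 1`, implied by `(471·N·β)² ≤ 1` as
`471² = 221841`).  For `SU(2)`, fundamental (`N = 2`, `β_W = 2β`): `β_W ≤ 1/471 ≈ 2.12·10⁻³` — sixteen times the
`L⁶`-law window `1/7525` (`coldDefect_eight_le_one_div_24_of_sq`) and ×313 the linear slab window `1/147456`. -/
theorem coldDefect_eight_le_one_div_24_of_cube (r : LatticeRep G) {β : ℝ} (hβ : 0 ≤ β)
    (h : 471 * r.N * β ≤ 1) : coldDefect r.ρ β 8 ≤ 1 / 24 := by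
  have h8 := coldDefect_latticeRep_le_cube_mul r hβ (L := 8) (by norm_num) ⟨4, rfl⟩
  have : (18 : ℝ) * (r.N : ℝ) ^ 2 * β ^ 2 * (8 : ℕ) ^ 3 = 9216 * ((r.N : ℝ) * β) ^ 2 := by push_cast; ring
  rw [this] at h8
  have hx0 : 0 ≤ (r.N : ℝ) * β := mul_nonneg (Nat.cast_nonneg _) hβ
  have hx : 471 * ((r.N : ℝ) * β) ≤ 1 := by linarith
  have hsq : (471 * ((r.N : ℝ) * β)) ^ 2 ≤ 1 := by nlinarith
  nlinarith

/-- **The `2⁻⁶` variant, cube law: `768·N·β ≤ 1 ⇒ δᶜ_β(8) ≤ 2⁻⁶`** (`18·8³·64 = 768²`; for `SU(2)`, fundamental: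
`β_W ≤ 1/768 ≈ 1.3·10⁻³`). -/
theorem coldDefect_eight_le_inv_two_pow_six_of_cube (r : LatticeRep G) {β : ℝ} (hβ : 0 ≤ β)
    (h : 768 * r.N * β ≤ 1) : coldDefect r.ρ β 8 ≤ 1 / 2 ^ 6 := by
  have h8 := coldDefect_latticeRep_le_cube_mul r hβ (L := 8) (by norm_num) ⟨4, rfl⟩
  have : (18 : ℝ) * (r.N : ℝ) ^ 2 * β ^ 2 * (8 : ℕ) ^ 3 = (768 * r.N * β) ^ 2 / 64 := by push_cast; ring
  rw [this] at h8
  have hx0 : 0 ≤ (768 : ℝ) * r.N * β := by positivity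
  have hsq : ((768 : ℝ) * r.N * β) ^ 2 ≤ 1 := by nlinarith
  calc coldDefect r.ρ β 8 ≤ (768 * r.N * β) ^ 2 / 64 := h8
    _ ≤ 1 / 64 := by linarith
    _ = 1 / 2 ^ 6 := by norm_num

end LatticeRepForms

end Summit.QuantumFields.YangMills.Cruxes.IR.ColdPurityGaussLaw

end
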